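import Literature.Analysis.OperatorTheory.Enflo2023.Eq45
import Literature.Analysis.OperatorTheory.Enflo2023.Pipeline
import HarnessLib

/-!
# Enflo 2023, v2 pp.17–20: the residual of Part B as ONE per-step claim, and its kernel-checked sufficiency

Source under adjudication: Per H. Enflo, *On the invariant subspace problem in Hilbert spaces*, arXiv:2305.15442 (v1
2023, v2 2024), bib key `Enflo2023` — a CLAIMED proof of the invariant subspace problem for operators on a separable
Hilbert space (claimed result under adjudication).  This file is part of the kernel-tight typing of the manuscript by
the b2b-enflo repair cell (formaliser 2, Part B: (28)–(47), the limiting argument and the final deduction; BLOCK-2b).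
NOTHING here asserts that the manuscript's main theorem holds: the main theorem of this file has the manuscript's
remaining claim as an explicit HYPOTHESIS (`MCStep.Claim`), and no declaration concludes the invariant subspace problem
for an arbitrary operator.  Value: the residual of Part B becomes one named `Prop`, and everything downstream of it —
the pivot-room bookkeeping (`PivotRoom`, `Eq45`), the summable rooms, the Cauchy argument and the non-cyclic limit
(`RoomsSuffice`), Part A's (9)/(16) at every state (`MinimalNorm`, `Pipeline`) — is kernel-checked to give a non-trivial
closed invariant subspace.  "Lean refuses" exactly at `MCStep.Claim`.

## The objects (true Main-Construction states, not abstract vectors)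

A state of the Main Construction (MC) is a minimal move (Part A, (1)–(5)): a coefficient operator `V : E →L[ℂ] H`
intertwining a fixed contraction `S` of the coefficient space with `T` (`V ∘ S = T ∘ V`; in the paper `E = ℓ²`,
`S` = the right shift, `V = V_y`, `b ↦ Σ bⱼ T^j y`), a radius `ε ∈ [0.3, 0.7]` and THE minimal solution `a = ℓ'` of (1)
(`IsMinimal V x₀ ε a`).  Its MC vector is `v = [ ]⁻¹x₀ = x₀ − Vℓ'` (`State.v`; `x₀ − v = Vℓ'` is the moved vector) and
its `(εθ) = Re⟨x₀ − Vℓ', Vℓ'⟩` (`State.etheta`).  For such states the standing hypotheses of the pivot-room theorem are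
THEOREMS, not clauses: the window `‖v‖ = ε ∈ [0.3, 0.7]` (`IsMinimal.norm_sub_eq`), (9) for every power
`|⟨v, T^j(x₀ − v)⟩| ≤ (εθ)` (`norm_inner_pow_le_etheta`, via `V ∘ S^j = T^j ∘ V`), and (16) `(εθ) = ⟨v, x₀ − v⟩ ∈ ℝ`
(`IsMinimal.etheta_im_eq_zero`).  (A per-step claim typed over ABSTRACT pairs `(v, E)` satisfying these would be
over-uniform — it can fail at pairs no MC run visits — hence the true-state typing.)

## The claim (v2 p.17 l.578–583, (40) p.18, (45)–(46) p.19, "continue MC with the extra condition" p.19 l.660–683)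

`MCStep.Claim T x₀ S C β G`: for every state `P` used as a PIVOT there is a side-condition vector `c ≠ 0` ((40): the
paper's `w₀₀`, built from `y_{n₀'}`; here free, with angle to the moved vector `x₀ − v_P` at most `G((εθ)_P)`) such
that from every state `s` of `P`'s epoch — typed history-free by the epoch invariant `InvP`: `(εθ)_s ≤ (εθ)_P`, the
accumulated side condition `⟨c, v_s − v_P⟩ = 0` ((46) summed) and the accumulated drift
`|Re⟨x₀, v_s − v_P⟩| ≤ C((εθ)_P − (εθ)_s)` ((45) summed) — ONE MORE MC STEP EXISTS: a state `s'` with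
(b') `(εθ)_{s'} ≤ (1 − β)(εθ)_s`, (46) `⟨c, v_{s'} − v_s⟩ = 0`, (45) `|Re⟨x₀, v_{s'} − v_s⟩| ≤ Cβ(εθ)_s`.
(`InvP` is preserved by such a step — `Setting.invP_step` — so the claim is only ever invoked along an epoch.)
This is the manuscript's "MC can be continued with the extra condition `⟨ch v, w⟩ = 0` to arbitrarily small `εθ`"
(p.19), with its first-order targets (41)–(45) in the weakest form the endgame needs (ratio `≤`, any `C ≥ 0`; the
printed constants of (40) and (45) are immaterial, rows B34–B35), the side condition imposed exactly (the cell's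
standing idealisation "ch = the actual increment", row B4), and uniformity over the epoch invariant in place of
"for the subsequent `n`".  What is NOT a clause because it is a theorem: (9), (16), the window, the rooms, the limit.

## The theorem

`MCStep.hasNontrivialClosedInvariantSubspace_of_claim`: `‖x₀‖ = 1`, `‖S‖ ≤ 1`, `0 ≤ C`, `0 < β ≤ 1`, `G ≥ 0` with
`G(E) → 0` as `E → 0⁺`, the Claim, and ONE state (Part A's output) ⟹ `T` has a non-trivial closed invariant subspace.
Proof = the run the manuscript describes, built by recursion with an ADAPTIVE pivot schedule (re-pivot as soon as
`2G((εθ)) + √((1+C)(εθ)) ≤ 2^{-(i+1)}`, which happens because `(εθ)_k ≤ (1−β)^k(εθ)_0 → 0`), fed to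
`Eq45.hasNontrivialClosedInvariantSubspace_of_repivoting_C` (epochs of (40)-pivots ⟹ summable rooms ⟹ Cauchy ⟹
non-cyclic limit, rows B32/B35).  Hence the certificate's last line: Part B of the manuscript is, kernel-tight,
EQUIVALENT IN USE to `MCStep.Claim`; the manuscript's argument for it is (34)–(37) ("surjectivity from
`s(εθ)`-independence", prose-verified in the finite-dimensional reading `SIndependent.exists_inner_eq`, resting on the
unformalised Fourier dictionary (28′)–(30″)) plus the unproved existence of ONE `s(εθ)`-schedule along the run
(GAP.md §F2 gen-7/gen-8; census R17(c)).
-/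

noncomputable section

open scoped InnerProductSpace ComplexConjugate
open Filter Topology RCLike

namespace Literature.Analysis.OperatorTheory.Enflo2023

namespace MCStep

variable {E H : Type*} [NormedAddCommGroup E] [InnerProductSpace ℂ E] [CompleteSpace E]
  [NormedAddCommGroup H] [InnerProductSpace ℂ H] [CompleteSpace H]

/-- A TRUE Main-Construction state: a coefficient operator `V` intertwining the contraction `S` with `T`
(`V_y`, `V_y ∘ S = T ∘ V_y`), a radius `ε ∈ [0.3, 0.7]`, and the minimal solution `a = ℓ'` of (1) at that radius.
[cite: Enflo2023, v2 (1)–(5), p.2–3; p.17] -/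
structure State (T : H →L[ℂ] H) (x₀ : H) (S : E →L[ℂ] E) where
  /-- the coefficient operator `V_y : b ↦ Σ bⱼ T^j y` -/
  V : E →L[ℂ] H
  /-- `V ∘ S = T ∘ V` -/
  hVS : ∀ b, V (S b) = T (V b)
  /-- the radius of the move -/
  ε : ℝ
  /-- the radius window of Part B -/
  hε : (0.3 : ℝ) ≤ ε ∧ ε ≤ 0.7
  /-- the minimal solution `ℓ'` of (1) -/
  a : E
  /-- minimality -/
  hmin : IsMinimal V x₀ ε a

namespace State

variable {T : H →L[ℂ] H} {x₀ : H} {S : E →L[ℂ] E}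

/-- The MC vector of the state, `[ ]⁻¹x₀ = x₀ − Vℓ'` (the `v_n` of `PivotRoom` / `RoomsSuffice`). [cite: Enflo2023, v2 (13), p.6] -/
def v (s : State T x₀ S) : H := x₀ - s.V s.a

/-- The state's `(εθ) = Re⟨x₀ − Vℓ', Vℓ'⟩`. [cite: Enflo2023, v2 (7)–(8), p.4] -/
def etheta (s : State T x₀ S) : ℝ := (⟪x₀ - s.V s.a, s.V s.a⟫_ℂ).re

omit [CompleteSpace E] [CompleteSpace H] in
/-- `x₀ − v = Vℓ'`, the moved vector. [cite: Enflo2023, v2 (13), p.6] -/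
lemma sub_v (s : State T x₀ S) : x₀ - s.v = s.V s.a := sub_sub_cancel _ _

omit [CompleteSpace E] [CompleteSpace H] in
/-- The radius is below `‖x₀‖ = 1`. [cite: Enflo2023, v2 p.2] -/
lemma eps_lt (s : State T x₀ S) (hx₀ : ‖x₀‖ = 1) : s.ε < ‖x₀‖ := by
  rw [hx₀]; linarith [s.hε.2]

omit [CompleteSpace E] [CompleteSpace H] in
/-- At a minimal move the constraint is active: `‖v‖ = ‖x₀ − Vℓ'‖ = ε`. [cite: Enflo2023, v2 (1), p.2] -/
lemma norm_v (s : State T x₀ S) (hx₀ : ‖x₀‖ = 1) : ‖s.v‖ = s.ε :=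
  s.hmin.norm_sub_eq (s.eps_lt hx₀)

omit [CompleteSpace E] [CompleteSpace H] in
/-- The window hypothesis of the pivot-room theorem is automatic. [cite: Enflo2023, v2 p.17] -/
lemma window (s : State T x₀ S) (hx₀ : ‖x₀‖ = 1) : (0.3 : ℝ) ≤ ‖s.v‖ ∧ ‖s.v‖ ≤ 0.7 := by
  rw [s.norm_v hx₀]; exact s.hε

/-- (9) for every power is automatic at a true MC state. [cite: Enflo2023, v2 (9), p.4] -/
lemma h9 (s : State T x₀ S) (hx₀ : ‖x₀‖ = 1) (hS : ‖S‖ ≤ 1) (j : ℕ) :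
    ‖⟪s.v, (T ^ j) (x₀ - s.v)⟫_ℂ‖ ≤ s.etheta := by
  rw [s.sub_v]
  exact norm_inner_pow_le_etheta s.hmin (s.eps_lt hx₀) S hS T s.hVS j

/-- (16)/(7): `⟨x₀ − Vℓ', Vℓ'⟩` is real at a minimal move. [cite: Enflo2023, v2 (7), p.4] -/
lemma etheta_im (s : State T x₀ S) (hx₀ : ‖x₀‖ = 1) : (⟪x₀ - s.V s.a, s.V s.a⟫_ℂ).im = 0 := by
  obtain ⟨C, -, hC⟩ := s.hmin.kkt (s.hmin.ne_zero (s.eps_lt hx₀))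
  exact IsMinimal.etheta_im_eq_zero hC

/-- The identity hypothesis `hid` of the pivot-room theorem is automatic: `(εθ) = ⟨v, x₀ − v⟩`. [cite: Enflo2023, v2 (16), p.6] -/
lemma hid (s : State T x₀ S) (hx₀ : ‖x₀‖ = 1) : ((s.etheta : ℝ) : ℂ) = ⟪s.v, x₀ - s.v⟫_ℂ := by
  rw [s.sub_v]
  apply Complex.ext
  · rw [Complex.ofReal_re]; rfl
  · rw [Complex.ofReal_im]; exact (s.etheta_im hx₀).symm

/-- `(εθ) ≥ 0` at a true MC state. [cite: Enflo2023, v2 (8), p.4] -/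
lemma etheta_nonneg (s : State T x₀ S) (hx₀ : ‖x₀‖ = 1) (hS : ‖S‖ ≤ 1) : 0 ≤ s.etheta :=
  le_trans (norm_nonneg _) (s.h9 hx₀ hS 0)

end State

/-- The EPOCH INVARIANT of a state `s` relative to a pivot `P` with side-condition vector `c` (history-free form of
"`s` is a later state of `P`'s epoch"): `(εθ)` has not increased, the side condition (46) has accumulated to
`⟨c, v_s − v_P⟩ = 0`, and the drift (45) has accumulated to `|Re⟨x₀, v_s − v_P⟩| ≤ C((εθ)_P − (εθ)_s)`.
[cite: Enflo2023, v2 (45)–(46), p.19] -/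
def InvP {T : H →L[ℂ] H} {x₀ : H} {S : E →L[ℂ] E} (C : ℝ) (P : State T x₀ S) (c : H)
    (s : State T x₀ S) : Prop :=
  s.etheta ≤ P.etheta ∧ ⟪c, s.v - P.v⟫_ℂ = 0 ∧ |re ⟪x₀, s.v - P.v⟫_ℂ| ≤ C * (P.etheta - s.etheta)

/-- **THE RESIDUAL CLAIM OF PART B** (v2 p.17 l.578–583 with (40), (45), (46)): at every pivot state `P` there is a
side-condition vector `c ≠ 0` within angle `G((εθ)_P)` of the moved vector `x₀ − v_P` ((40); the paper's `w₀₀`), such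
that from every state `s` in `P`'s epoch invariant ONE MORE Main-Construction step exists: a true MC state `s'` with
the ratio target (b') `(εθ)_{s'} ≤ (1−β)(εθ)_s`, the side condition (46) `⟨c, v_{s'} − v_s⟩ = 0` and the drift bound
(45) `|Re⟨x₀, v_{s'} − v_s⟩| ≤ Cβ(εθ)_s`.  A HYPOTHESIS below, never a theorem. [cite: Enflo2023, v2 p.17–19, (40), (45), (46)] -/
def Claim (T : H →L[ℂ] H) (x₀ : H) (S : E →L[ℂ] E) (C β : ℝ) (G : ℝ → ℝ) : Prop :=
  ∀ P : State T x₀ S, ∃ c : H, c ≠ 0 ∧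
    ‖((‖x₀ - P.v‖ : ℝ) : ℂ) • c - ((‖c‖ : ℝ) : ℂ) • (x₀ - P.v)‖ ≤ G P.etheta * (‖c‖ * ‖x₀ - P.v‖) ∧
    ∀ s : State T x₀ S, InvP C P c s →
      ∃ s' : State T x₀ S, s'.etheta ≤ (1 - β) * s.etheta ∧ ⟪c, s'.v - s.v⟫_ℂ = 0 ∧
        |re ⟪x₀, s'.v - s.v⟫_ℂ| ≤ C * β * s.etheta

/-- The data and standing hypotheses of the endgame, bundled: `T`, `x₀` (`‖x₀‖ = 1`), the contraction `S`, the
constants `C ≥ 0`, `0 < β ≤ 1`, the angle modulus `G ≥ 0` with `G(E) → 0` as `E → 0⁺` ((40) ⇐ (33): `Eq40`'s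
`8‖T‖√γ'(E)`), the Claim, and one initial state (Part A). [cite: Enflo2023, v2 p.17–20] -/
structure Setting (E H : Type*) [NormedAddCommGroup E] [InnerProductSpace ℂ E] [CompleteSpace E]
    [NormedAddCommGroup H] [InnerProductSpace ℂ H] [CompleteSpace H] where
  /-- the operator -/
  T : H →L[ℂ] H
  /-- the unit vector `x₀` -/
  x₀ : H
  /-- the contraction of the coefficient space (the right shift of `ℓ²`) -/
  S : E →L[ℂ] E
  /-- the drift constant of (45) -/
  C : ℝ
  /-- the ratio of (b') -/
  β : ℝ
  /-- the angle modulus of (40) as a function of `(εθ)` -/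
  G : ℝ → ℝ
  /-- `‖x₀‖ = 1` -/
  hx₀ : ‖x₀‖ = 1
  /-- `S` is a contraction -/
  hS : ‖S‖ ≤ 1
  /-- `C ≥ 0` -/
  hC : 0 ≤ C
  /-- `β > 0` -/
  hβ : 0 < β
  /-- `β ≤ 1` -/
  hβ1 : β ≤ 1
  /-- `G ≥ 0` -/
  hG0 : ∀ x, 0 ≤ G x
  /-- `G(E) → 0` as `E → 0⁺` -/
  hG : ∀ η : ℝ, 0 < η → ∃ δ : ℝ, 0 < δ ∧ ∀ x, 0 ≤ x → x ≤ δ → G x ≤ η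
  /-- the residual claim of Part B -/
  claim : Claim T x₀ S C β G
  /-- an initial MC state (Part A's output) -/
  s₀ : State T x₀ S

namespace Setting

variable (𝔰 : Setting E H)

/-- The side-condition vector the Claim provides at a pivot. [cite: Enflo2023, v2 (40), p.18] -/
def piv (P : State 𝔰.T 𝔰.x₀ 𝔰.S) : H := Classical.choose (𝔰.claim P)

/-- It is non-zero. [cite: Enflo2023, v2 (40), p.18] -/
lemma piv_ne_zero (P : State 𝔰.T 𝔰.x₀ 𝔰.S) : 𝔰.piv P ≠ 0 := (Classical.choose_spec (𝔰.claim P)).1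

/-- Its angle to the moved vector is at most `G((εθ)_P)` ((40)). [cite: Enflo2023, v2 (40), p.18] -/
lemma piv_angle (P : State 𝔰.T 𝔰.x₀ 𝔰.S) :
    ‖((‖𝔰.x₀ - P.v‖ : ℝ) : ℂ) • 𝔰.piv P - ((‖𝔰.piv P‖ : ℝ) : ℂ) • (𝔰.x₀ - P.v)‖
      ≤ 𝔰.G P.etheta * (‖𝔰.piv P‖ * ‖𝔰.x₀ - P.v‖) :=
  (Classical.choose_spec (𝔰.claim P)).2.1

/-- The step the Claim provides from a state in the epoch invariant. [cite: Enflo2023, v2 p.19] -/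
lemma piv_step (P s : State 𝔰.T 𝔰.x₀ 𝔰.S) (h : InvP 𝔰.C P (𝔰.piv P) s) :
    ∃ s' : State 𝔰.T 𝔰.x₀ 𝔰.S, s'.etheta ≤ (1 - 𝔰.β) * s.etheta ∧ ⟪𝔰.piv P, s'.v - s.v⟫_ℂ = 0 ∧
      |re ⟪𝔰.x₀, s'.v - s.v⟫_ℂ| ≤ 𝔰.C * 𝔰.β * s.etheta :=
  (Classical.choose_spec (𝔰.claim P)).2.2 s h

/-- The next state (a choice). [cite: Enflo2023, v2 p.19] -/
def step (P s : State 𝔰.T 𝔰.x₀ 𝔰.S) (h : InvP 𝔰.C P (𝔰.piv P) s) : State 𝔰.T 𝔰.x₀ 𝔰.S :=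
  Classical.choose (𝔰.piv_step P s h)

/-- (b') at the step. [cite: Enflo2023, v2 (b'), p.17] -/
lemma step_ratio (P s : State 𝔰.T 𝔰.x₀ 𝔰.S) (h : InvP 𝔰.C P (𝔰.piv P) s) :
    (𝔰.step P s h).etheta ≤ (1 - 𝔰.β) * s.etheta :=
  (Classical.choose_spec (𝔰.piv_step P s h)).1

/-- (46) at the step. [cite: Enflo2023, v2 (46), p.19] -/
lemma step_constraint (P s : State 𝔰.T 𝔰.x₀ 𝔰.S) (h : InvP 𝔰.C P (𝔰.piv P) s) :
    ⟪𝔰.piv P, (𝔰.step P s h).v - s.v⟫_ℂ = 0 :=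
  (Classical.choose_spec (𝔰.piv_step P s h)).2.1

/-- (45) at the step. [cite: Enflo2023, v2 (45), p.19] -/
lemma step_drift (P s : State 𝔰.T 𝔰.x₀ 𝔰.S) (h : InvP 𝔰.C P (𝔰.piv P) s) :
    |re ⟪𝔰.x₀, (𝔰.step P s h).v - s.v⟫_ℂ| ≤ 𝔰.C * 𝔰.β * s.etheta :=
  (Classical.choose_spec (𝔰.piv_step P s h)).2.2

/-- A pivot is in its own epoch invariant. [cite: Enflo2023, v2 p.19] -/
lemma invP_self (P : State 𝔰.T 𝔰.x₀ 𝔰.S) (c : H) : InvP 𝔰.C P c P := by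
  refine ⟨le_rfl, ?_, ?_⟩
  · simp
  · simp

/-- The epoch invariant is preserved by a step of the Claim ((45), (46) and (b') accumulate). [cite: Enflo2023, v2 (45)–(46), p.19] -/
lemma invP_step (P s : State 𝔰.T 𝔰.x₀ 𝔰.S) (h : InvP 𝔰.C P (𝔰.piv P) s) :
    InvP 𝔰.C P (𝔰.piv P) (𝔰.step P s h) := by
  have hE := h.1
  have hc := h.2.1
  have hd := h.2.2
  have hr := 𝔰.step_ratio P s h
  have hcs := 𝔰.step_constraint P s h
  have hds := 𝔰.step_drift P s h
  have hEs : 0 ≤ s.etheta := s.etheta_nonneg 𝔰.hx₀ 𝔰.hS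
  have hsplit : (𝔰.step P s h).v - P.v = ((𝔰.step P s h).v - s.v) + (s.v - P.v) := by abel
  refine ⟨?_, ?_, ?_⟩
  · have : 0 ≤ 𝔰.β * s.etheta := mul_nonneg 𝔰.hβ.le hEs
    linarith
  · rw [hsplit, inner_add_right, hcs, hc, add_zero]
  · rw [hsplit, inner_add_right, map_add]
    have h1 := abs_add_le (re ⟪𝔰.x₀, (𝔰.step P s h).v - s.v⟫_ℂ) (re ⟪𝔰.x₀, s.v - P.v⟫_ℂ)
    have h2 : 𝔰.C * 𝔰.β * s.etheta ≤ 𝔰.C * (s.etheta - (𝔰.step P s h).etheta) := by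
      have : 𝔰.β * s.etheta ≤ s.etheta - (𝔰.step P s h).etheta := by linarith
      calc 𝔰.C * 𝔰.β * s.etheta = 𝔰.C * (𝔰.β * s.etheta) := by ring
        _ ≤ 𝔰.C * (s.etheta - (𝔰.step P s h).etheta) := mul_le_mul_of_nonneg_left this 𝔰.hC
    linarith

/-- The state of the run recursion: current pivot `P`, current state `s` in `P`'s epoch invariant, epoch index `i`. [cite: Enflo2023, v2 p.19–20] -/
structure RunState where
  /-- current pivot -/
  P : State 𝔰.T 𝔰.x₀ 𝔰.S
  /-- current state -/
  s : State 𝔰.T 𝔰.x₀ 𝔰.S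
  /-- number of re-pivots so far -/
  i : ℕ
  /-- the epoch invariant -/
  h : InvP 𝔰.C P (𝔰.piv P) s

/-- The ADAPTIVE re-pivoting rule: re-pivot at a state as soon as its room modulus `2G((εθ)) + √((1+C)(εθ))` is below
`2^{-j}` (the manuscript: pivots at `δ₂^40, δ₂^400, …`, p.20). [cite: Enflo2023, v2 p.20] -/
def thresh (s : State 𝔰.T 𝔰.x₀ 𝔰.S) (j : ℕ) : Prop :=
  2 * 𝔰.G s.etheta + Real.sqrt ((1 + 𝔰.C) * s.etheta) ≤ (1 / 2 : ℝ) ^ j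

open Classical in
/-- One step of the run: take the Claim's step; re-pivot there if the threshold for the next epoch is met. [cite: Enflo2023, v2 p.19–20] -/
def next (r : 𝔰.RunState) : 𝔰.RunState :=
  if 𝔰.thresh (𝔰.step r.P r.s r.h) (r.i + 1) then
    ⟨𝔰.step r.P r.s r.h, 𝔰.step r.P r.s r.h, r.i + 1, 𝔰.invP_self _ _⟩
  else ⟨r.P, 𝔰.step r.P r.s r.h, r.i, 𝔰.invP_step r.P r.s r.h⟩

/-- The run: start at `s₀` as pivot `0`, iterate `next`. [cite: Enflo2023, v2 p.19–20] -/
def run : ℕ → 𝔰.RunState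
  | 0 => ⟨𝔰.s₀, 𝔰.s₀, 0, 𝔰.invP_self _ _⟩
  | k + 1 => 𝔰.next (run k)

/-- The MC vectors `v_k = [ ]_k⁻¹ x₀` of the run. [cite: Enflo2023, v2 p.19] -/
def vseq (k : ℕ) : H := (𝔰.run k).s.v

/-- The `(εθ)_k` of the run. [cite: Enflo2023, v2 p.19] -/
def eseq (k : ℕ) : ℝ := (𝔰.run k).s.etheta

/-- The epoch index at time `k`. [cite: Enflo2023, v2 p.20] -/
def idx (k : ℕ) : ℕ := (𝔰.run k).i

/-- Unfolding `next` when the threshold is met. [folklore] -/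
lemma next_eq_of_thresh (r : 𝔰.RunState) (h : 𝔰.thresh (𝔰.step r.P r.s r.h) (r.i + 1)) :
    𝔰.next r = ⟨𝔰.step r.P r.s r.h, 𝔰.step r.P r.s r.h, r.i + 1, 𝔰.invP_self _ _⟩ := by
  unfold next; rw [if_pos h]

/-- Unfolding `next` when the threshold is not met. [folklore] -/
lemma next_eq_of_not_thresh (r : 𝔰.RunState) (h : ¬ 𝔰.thresh (𝔰.step r.P r.s r.h) (r.i + 1)) :
    𝔰.next r = ⟨r.P, 𝔰.step r.P r.s r.h, r.i, 𝔰.invP_step r.P r.s r.h⟩ := by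
  unfold next; rw [if_neg h]

/-- `run (k+1) = next (run k)`. [folklore] -/
lemma run_succ (k : ℕ) : 𝔰.run (k + 1) = 𝔰.next (𝔰.run k) := rfl

/-- The state component always advances by the Claim's step. [folklore] -/
lemma run_succ_s (k : ℕ) : (𝔰.run (k + 1)).s = 𝔰.step (𝔰.run k).P (𝔰.run k).s (𝔰.run k).h := by
  by_cases h : 𝔰.thresh (𝔰.step (𝔰.run k).P (𝔰.run k).s (𝔰.run k).h) ((𝔰.run k).i + 1)
  · rw [run_succ, 𝔰.next_eq_of_thresh _ h]
  · rw [run_succ, 𝔰.next_eq_of_not_thresh _ h]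

/-- The two cases of a step: re-pivot (index up, pivot := new state, threshold met) or not (index and pivot kept). [folklore] -/
lemma succ_cases (k : ℕ) :
    (𝔰.thresh (𝔰.run (k + 1)).s (𝔰.idx k + 1) ∧ 𝔰.idx (k + 1) = 𝔰.idx k + 1 ∧
        (𝔰.run (k + 1)).P = (𝔰.run (k + 1)).s) ∨
    (¬ 𝔰.thresh (𝔰.run (k + 1)).s (𝔰.idx k + 1) ∧ 𝔰.idx (k + 1) = 𝔰.idx k ∧
        (𝔰.run (k + 1)).P = (𝔰.run k).P) := by
  by_cases h : 𝔰.thresh (𝔰.step (𝔰.run k).P (𝔰.run k).s (𝔰.run k).h) ((𝔰.run k).i + 1)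
  · left
    have e := 𝔰.next_eq_of_thresh _ h
    refine ⟨?_, ?_, ?_⟩
    · rw [run_succ_s]; exact h
    · show (𝔰.run (k + 1)).i = (𝔰.run k).i + 1
      rw [run_succ, e]
    · rw [run_succ, e]
  · right
    have e := 𝔰.next_eq_of_not_thresh _ h
    refine ⟨?_, ?_, ?_⟩
    · rw [run_succ_s]; exact h
    · show (𝔰.run (k + 1)).i = (𝔰.run k).i
      rw [run_succ, e]
    · rw [run_succ, e]

/-- `idx 0 = 0`. [folklore] -/
lemma idx_zero : 𝔰.idx 0 = 0 := rfl

/-- (b') along the run: `(εθ)_{k+1} ≤ (1−β)(εθ)_k`. [cite: Enflo2023, v2 (b'), p.17] -/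
lemma eseq_succ_le (k : ℕ) : 𝔰.eseq (k + 1) ≤ (1 - 𝔰.β) * 𝔰.eseq k := by
  show (𝔰.run (k + 1)).s.etheta ≤ (1 - 𝔰.β) * (𝔰.run k).s.etheta
  rw [run_succ_s]; exact 𝔰.step_ratio _ _ _

/-- (45) along the run. [cite: Enflo2023, v2 (45), p.19] -/
lemma drift_succ (k : ℕ) : |re ⟪𝔰.x₀, 𝔰.vseq (k + 1) - 𝔰.vseq k⟫_ℂ| ≤ 𝔰.C * 𝔰.β * 𝔰.eseq k := by
  show |re ⟪𝔰.x₀, (𝔰.run (k + 1)).s.v - (𝔰.run k).s.v⟫_ℂ| ≤ 𝔰.C * 𝔰.β * (𝔰.run k).s.etheta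
  rw [run_succ_s]; exact 𝔰.step_drift _ _ _

/-- (46) along the run, with the CURRENT pivot's side-condition vector. [cite: Enflo2023, v2 (46), p.19] -/
lemma constraint_succ (k : ℕ) : ⟪𝔰.piv (𝔰.run k).P, 𝔰.vseq (k + 1) - 𝔰.vseq k⟫_ℂ = 0 := by
  show ⟪𝔰.piv (𝔰.run k).P, (𝔰.run (k + 1)).s.v - (𝔰.run k).s.v⟫_ℂ = 0
  rw [run_succ_s]; exact 𝔰.step_constraint _ _ _

/-- `(εθ)_k ≥ 0`. [cite: Enflo2023, v2 (8), p.4] -/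
lemma eseq_nonneg (k : ℕ) : 0 ≤ 𝔰.eseq k := (𝔰.run k).s.etheta_nonneg 𝔰.hx₀ 𝔰.hS

/-- Geometric decay `(εθ)_k ≤ (1−β)^k (εθ)_0`. [cite: Enflo2023, v2 (b'), p.17] -/
lemma eseq_le_pow (k : ℕ) : 𝔰.eseq k ≤ (1 - 𝔰.β) ^ k * 𝔰.eseq 0 := by
  induction k with
  | zero => simp
  | succ k ih =>
    have hb : 0 ≤ 1 - 𝔰.β := by linarith [𝔰.hβ1]
    calc 𝔰.eseq (k + 1) ≤ (1 - 𝔰.β) * 𝔰.eseq k := 𝔰.eseq_succ_le k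
      _ ≤ (1 - 𝔰.β) * ((1 - 𝔰.β) ^ k * 𝔰.eseq 0) := mul_le_mul_of_nonneg_left ih hb
      _ = (1 - 𝔰.β) ^ (k + 1) * 𝔰.eseq 0 := by ring

/-- `(εθ)_k → 0` — the Main Construction reaches arbitrarily small `εθ` (given the Claim). [cite: Enflo2023, v2 p.19] -/
lemma eseq_tendsto : Tendsto 𝔰.eseq atTop (𝓝 0) := by
  have hb0 : 0 ≤ 1 - 𝔰.β := by linarith [𝔰.hβ1]
  have hb1 : 1 - 𝔰.β < 1 := by linarith [𝔰.hβ]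
  have hg : Tendsto (fun k => (1 - 𝔰.β) ^ k * 𝔰.eseq 0) atTop (𝓝 0) := by
    simpa using (tendsto_pow_atTop_nhds_zero_of_lt_one hb0 hb1).mul_const (𝔰.eseq 0)
  exact squeeze_zero (fun k => 𝔰.eseq_nonneg k) (fun k => 𝔰.eseq_le_pow k) hg

/-- `(εθ)_k` is non-increasing. [cite: Enflo2023, v2 (b'), p.17] -/
lemma eseq_antitone : Antitone 𝔰.eseq := antitone_nat_of_succ_le fun k => by
  have h1 := 𝔰.eseq_succ_le k
  have h2 : 0 ≤ 𝔰.β * 𝔰.eseq k := mul_nonneg 𝔰.hβ.le (𝔰.eseq_nonneg k)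
  nlinarith

/-- The epoch index moves by `0` or `+1`. [folklore] -/
lemma idx_succ (k : ℕ) : 𝔰.idx (k + 1) = 𝔰.idx k + 1 ∨ 𝔰.idx (k + 1) = 𝔰.idx k := by
  rcases 𝔰.succ_cases k with ⟨-, h, -⟩ | ⟨-, h, -⟩
  exacts [Or.inl h, Or.inr h]

/-- The epoch index is monotone. [folklore] -/
lemma idx_mono : Monotone 𝔰.idx := monotone_nat_of_le_succ fun k => by
  rcases 𝔰.idx_succ k with h | h <;> omega

/-- Discrete intermediate values: every index value `≤ idx k` is attained at or before `k`. [folklore] -/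
lemma exists_idx_eq_of_le {j k : ℕ} (h : j ≤ 𝔰.idx k) : ∃ k' ≤ k, 𝔰.idx k' = j := by
  induction k with
  | zero => exact ⟨0, le_rfl, by have := 𝔰.idx_zero; omega⟩
  | succ k ih =>
    by_cases hk : j ≤ 𝔰.idx k
    · obtain ⟨k', hk', e⟩ := ih hk
      exact ⟨k', by omega, e⟩
    · refine ⟨k + 1, le_rfl, ?_⟩
      rcases 𝔰.idx_succ k with h' | h' <;> omega

/-- The re-pivoting threshold of any fixed level is eventually met (because `(εθ)_k → 0` and `G → 0`). [cite: Enflo2023, v2 p.20] -/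
lemma thresh_eventually (j : ℕ) : ∀ᶠ k in atTop, 𝔰.thresh (𝔰.run k).s j := by
  obtain ⟨δ, hδ, hGδ⟩ := 𝔰.hG ((1 / 2 : ℝ) ^ j / 4) (by positivity)
  have hC1 : (0 : ℝ) < 1 + 𝔰.C := by linarith [𝔰.hC]
  have hμ : (0 : ℝ) < ((1 / 2 : ℝ) ^ j / 2) ^ 2 / (1 + 𝔰.C) := div_pos (by positivity) hC1
  have h1 : ∀ᶠ k in atTop, 𝔰.eseq k ≤ δ := 𝔰.eseq_tendsto.eventually (eventually_le_nhds hδ)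
  have h2 : ∀ᶠ k in atTop, 𝔰.eseq k ≤ ((1 / 2 : ℝ) ^ j / 2) ^ 2 / (1 + 𝔰.C) :=
    𝔰.eseq_tendsto.eventually (eventually_le_nhds hμ)
  filter_upwards [h1, h2] with k hk1 hk2
  have hGk : 𝔰.G (𝔰.eseq k) ≤ (1 / 2 : ℝ) ^ j / 4 := hGδ _ (𝔰.eseq_nonneg k) hk1
  have hsq : Real.sqrt ((1 + 𝔰.C) * 𝔰.eseq k) ≤ (1 / 2 : ℝ) ^ j / 2 := by
    have hle : (1 + 𝔰.C) * 𝔰.eseq k ≤ ((1 / 2 : ℝ) ^ j / 2) ^ 2 := by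
      have := (le_div_iff₀ hC1).1 hk2
      linarith
    calc Real.sqrt ((1 + 𝔰.C) * 𝔰.eseq k) ≤ Real.sqrt (((1 / 2 : ℝ) ^ j / 2) ^ 2) :=
          Real.sqrt_le_sqrt hle
      _ = (1 / 2 : ℝ) ^ j / 2 := Real.sqrt_sq (by positivity)
  show 2 * 𝔰.G (𝔰.eseq k) + Real.sqrt ((1 + 𝔰.C) * 𝔰.eseq k) ≤ (1 / 2 : ℝ) ^ j
  linarith

/-- The epoch index is unbounded: the run re-pivots infinitely often. [cite: Enflo2023, v2 p.20] -/
lemma idx_unbounded (j : ℕ) : ∃ k, j ≤ 𝔰.idx k := by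
  induction j with
  | zero => exact ⟨0, Nat.zero_le _⟩
  | succ j ih =>
    obtain ⟨k₀, hk₀⟩ := ih
    by_contra hcon
    have hcon : ∀ k, 𝔰.idx k < j + 1 := fun k => not_le.mp fun hle => hcon ⟨k, hle⟩
    have hconst : ∀ k, k₀ ≤ k → 𝔰.idx k = j := fun k hk => by
      have h1 := 𝔰.idx_mono hk
      have h2 := hcon k
      omega
    obtain ⟨k, hth, hk⟩ := ((𝔰.thresh_eventually (j + 1)).and (eventually_ge_atTop (k₀ + 1))).exists
    obtain ⟨m, rfl⟩ : ∃ m, k = m + 1 := ⟨k - 1, by omega⟩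
    have hm : 𝔰.idx m = j := hconst m (by omega)
    rcases 𝔰.succ_cases m with ⟨-, hi, -⟩ | ⟨hnt, -, -⟩
    · have := hcon (m + 1); omega
    · exact hnt (by rw [hm]; exact hth)

/-- Every epoch index is attained. [folklore] -/
lemma exists_idx_eq (j : ℕ) : ∃ k, 𝔰.idx k = j := by
  obtain ⟨k, hk⟩ := 𝔰.idx_unbounded j
  obtain ⟨k', -, e⟩ := 𝔰.exists_idx_eq_of_le hk
  exact ⟨k', e⟩

/-- The pivot times: `p j` = the first time the epoch index is `j`. [cite: Enflo2023, v2 p.20] -/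
def p (j : ℕ) : ℕ := Nat.find (𝔰.exists_idx_eq j)

/-- `idx (p j) = j`. [folklore] -/
lemma idx_p (j : ℕ) : 𝔰.idx (𝔰.p j) = j := Nat.find_spec (𝔰.exists_idx_eq j)

/-- `p j` is the least time with index `j`. [folklore] -/
lemma p_le {j k : ℕ} (h : 𝔰.idx k = j) : 𝔰.p j ≤ k := Nat.find_min' _ h

/-- `p 0 = 0`. [folklore] -/
lemma p_zero : 𝔰.p 0 = 0 := by
  have := 𝔰.p_le (j := 0) (k := 0) 𝔰.idx_zero; omega

/-- The pivot times are strictly increasing. [folklore] -/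
lemma p_strictMono : StrictMono 𝔰.p := strictMono_nat_of_lt_succ fun j => by
  refine not_le.mp fun h => ?_
  have := 𝔰.idx_mono h
  rw [𝔰.idx_p, 𝔰.idx_p] at this
  omega

/-- Times in `[p j, p (j+1))` carry epoch index `j`. [folklore] -/
lemma idx_eq_of_mem_epoch {j k : ℕ} (h1 : 𝔰.p j ≤ k) (h2 : k < 𝔰.p (j + 1)) : 𝔰.idx k = j := by
  have hge : j ≤ 𝔰.idx k := by
    have := 𝔰.idx_mono h1; rw [𝔰.idx_p] at this; exact this
  by_contra hne
  have hgt : j + 1 ≤ 𝔰.idx k := by omega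
  obtain ⟨k', hk', e⟩ := 𝔰.exists_idx_eq_of_le hgt
  have := 𝔰.p_le e
  omega

/-- While the epoch index is `j`, the current pivot is the state at time `p j`. [folklore] -/
lemma P_eq_of_idx : ∀ k j, 𝔰.idx k = j → (𝔰.run k).P = (𝔰.run (𝔰.p j)).s := by
  intro k
  induction k with
  | zero =>
    intro j hj
    rw [𝔰.idx_zero] at hj
    subst hj
    have e : 𝔰.p 0 = 0 := 𝔰.p_zero
    calc (𝔰.run 0).P = (𝔰.run 0).s := rfl
      _ = (𝔰.run (𝔰.p 0)).s := by rw [e]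
  | succ k ih =>
    intro j hj
    rcases 𝔰.succ_cases k with ⟨-, hi, hP⟩ | ⟨-, hi, hP⟩
    · have hpj : 𝔰.p j = k + 1 := by
        have h1 : 𝔰.p j ≤ k + 1 := 𝔰.p_le hj
        have h2 : ¬ 𝔰.p j ≤ k := fun hle => by
          have := 𝔰.idx_mono hle; rw [𝔰.idx_p] at this; omega
        omega
      rw [hP, hpj]
    · rw [hP]; exact ih j (by omega)

/-- The side-condition vector of epoch `j` (the `w₀₀` of the `j`-th pivot). [cite: Enflo2023, v2 (40), p.18] -/
def cvec (j : ℕ) : H := 𝔰.piv (𝔰.run (𝔰.p j)).s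

/-- The angle bound of epoch `j`: `G((εθ)_{p j})`. [cite: Enflo2023, v2 (40), p.18] -/
def gseq (j : ℕ) : ℝ := 𝔰.G (𝔰.eseq (𝔰.p j))

/-- (46) holds throughout epoch `j` with the epoch's vector. [cite: Enflo2023, v2 (46), p.19] -/
lemma hc (j k : ℕ) (h1 : 𝔰.p j ≤ k) (h2 : k < 𝔰.p (j + 1)) :
    ⟪𝔰.cvec j, 𝔰.vseq (k + 1) - 𝔰.vseq k⟫_ℂ = 0 := by
  have hP := 𝔰.P_eq_of_idx k j (𝔰.idx_eq_of_mem_epoch h1 h2)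
  have := 𝔰.constraint_succ k
  rw [hP] at this
  exact this

/-- (40) at every pivot. [cite: Enflo2023, v2 (40), p.18] -/
lemma hang (j : ℕ) :
    ‖((‖𝔰.x₀ - 𝔰.vseq (𝔰.p j)‖ : ℝ) : ℂ) • 𝔰.cvec j - ((‖𝔰.cvec j‖ : ℝ) : ℂ) • (𝔰.x₀ - 𝔰.vseq (𝔰.p j))‖
      ≤ 𝔰.gseq j * (‖𝔰.cvec j‖ * ‖𝔰.x₀ - 𝔰.vseq (𝔰.p j)‖) :=
  𝔰.piv_angle (𝔰.run (𝔰.p j)).s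

/-- At the `(j+1)`-st pivot the threshold of level `j+1` was met. [folklore] -/
lemma thresh_p_succ (j : ℕ) : 𝔰.thresh (𝔰.run (𝔰.p (j + 1))).s (j + 1) := by
  obtain ⟨m, hm⟩ : ∃ m, 𝔰.p (j + 1) = m + 1 :=
    ⟨𝔰.p (j + 1) - 1, by have := 𝔰.p_strictMono (Nat.lt_add_one j); omega⟩
  have h1 : 𝔰.idx (m + 1) = j + 1 := by rw [← hm]; exact 𝔰.idx_p _
  have h2 : 𝔰.idx m ≤ j := by
    refine not_lt.mp fun h => ?_
    obtain ⟨k', hk', e⟩ := 𝔰.exists_idx_eq_of_le (show j + 1 ≤ 𝔰.idx m by omega)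
    have := 𝔰.p_le e
    omega
  rcases 𝔰.succ_cases m with ⟨ht, hi, -⟩ | ⟨-, hi, -⟩
  · have hmj : 𝔰.idx m = j := by omega
    rw [hm]; rw [hmj] at ht; exact ht
  · omega

/-- The rooms are summable: `Σ_j (2 g_j + √((1+C)(εθ)_{p j})) < ∞` (each term `≤ 2^{-j}` for `j ≥ 1`). [cite: Enflo2023, v2 p.20] -/
lemma summable_terms :
    Summable (fun j => 2 * 𝔰.gseq j + Real.sqrt ((1 + 𝔰.C) * 𝔰.eseq (𝔰.p j))) := by
  have hnn : ∀ j, 0 ≤ 2 * 𝔰.gseq j + Real.sqrt ((1 + 𝔰.C) * 𝔰.eseq (𝔰.p j)) := fun j =>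
    add_nonneg (mul_nonneg zero_le_two (𝔰.hG0 _)) (Real.sqrt_nonneg _)
  rw [← summable_nat_add_iff 1]
  have hgeo : Summable (fun j : ℕ => (1 / 2 : ℝ) ^ (j + 1)) :=
    ((summable_geometric_of_lt_one (by norm_num : (0 : ℝ) ≤ 1 / 2) (by norm_num)).mul_right
      (1 / 2)).congr (fun j => by ring)
  refine Summable.of_nonneg_of_le (fun j => hnn (j + 1)) (fun j => ?_) hgeo
  have h := 𝔰.thresh_p_succ j
  unfold thresh at h
  exact h

/-- **The endgame from the Claim.**  The run built from the Claim satisfies every hypothesis of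
`Eq45.hasNontrivialClosedInvariantSubspace_of_repivoting_C`; hence `T` has a non-trivial closed invariant subspace.
[cite: Enflo2023, v2 p.17–20, (40), (45)–(47)] -/
theorem hasNontrivialClosedInvariantSubspace : HasNontrivialClosedInvariantSubspace 𝔰.T :=
  Eq45.hasNontrivialClosedInvariantSubspace_of_repivoting_C 𝔰.T 𝔰.x₀ 𝔰.hx₀ 𝔰.vseq 𝔰.eseq 𝔰.β 𝔰.C 𝔰.hC
    (fun n => (𝔰.run n).s.window 𝔰.hx₀)
    (fun n j => (𝔰.run n).s.h9 𝔰.hx₀ 𝔰.hS j)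
    (fun m => (𝔰.run m).s.hid 𝔰.hx₀)
    𝔰.eseq_nonneg 𝔰.eseq_antitone 𝔰.eseq_tendsto
    𝔰.drift_succ 𝔰.eseq_succ_le
    𝔰.p 𝔰.p_strictMono 𝔰.cvec 𝔰.gseq (fun j => 𝔰.piv_ne_zero (𝔰.run (𝔰.p j)).s) (fun j => 𝔰.hG0 (𝔰.eseq (𝔰.p j)))
    𝔰.hang 𝔰.hc 𝔰.summable_terms

end Setting

/-- **Part B is, kernel-tight, the per-step claim.**  For an operator `T`, a unit vector `x₀`, a contraction `S` of
the coefficient space, constants `C ≥ 0`, `0 < β ≤ 1`, an angle modulus `G ≥ 0` with `G(E) → 0` as `E → 0⁺`: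
IF the residual claim `MCStep.Claim T x₀ S C β G` of the manuscript holds and ONE Main-Construction state exists
(Part A), THEN `T` has a non-trivial closed invariant subspace.  The Claim is the hypothesis Lean cannot discharge
(v2 p.17 l.578–583, argued in the text by (34)–(37)); everything else of pp.17–20 is proved. [cite: Enflo2023, v2 p.17–20, (40), (45)–(47), (11)] -/
theorem hasNontrivialClosedInvariantSubspace_of_claim (T : H →L[ℂ] H) (x₀ : H) (hx₀ : ‖x₀‖ = 1)
    (S : E →L[ℂ] E) (hS : ‖S‖ ≤ 1) {C β : ℝ} (hC : 0 ≤ C) (hβ : 0 < β) (hβ1 : β ≤ 1)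
    (G : ℝ → ℝ) (hG0 : ∀ x, 0 ≤ G x)
    (hG : ∀ η : ℝ, 0 < η → ∃ δ : ℝ, 0 < δ ∧ ∀ x, 0 ≤ x → x ≤ δ → G x ≤ η)
    (hclaim : Claim T x₀ S C β G) (s₀ : State T x₀ S) :
    HasNontrivialClosedInvariantSubspace T :=
  Setting.hasNontrivialClosedInvariantSubspace ⟨T, x₀, S, C, β, G, hx₀, hS, hC, hβ, hβ1, hG0, hG, hclaim, s₀⟩

omit [CompleteSpace E] [CompleteSpace H] in
/-- The pivot clause of the Claim is never the obstruction: the moved vector `x₀ − v_P` itself (v1's reading of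
`w₀₀`) is admissible with angle `0`, for any `G ≥ 0`.  The content of the Claim is the STEP clause. [cite: Enflo2023, v1 p.11; v2 (40), p.18] -/
theorem pivot_clause_trivial {T : H →L[ℂ] H} {x₀ : H} {S : E →L[ℂ] E} (hx₀ : ‖x₀‖ = 1)
    (G : ℝ → ℝ) (hG0 : ∀ x, 0 ≤ G x) (P : State T x₀ S) :
    (x₀ - P.v) ≠ 0 ∧
      ‖((‖x₀ - P.v‖ : ℝ) : ℂ) • (x₀ - P.v) - ((‖x₀ - P.v‖ : ℝ) : ℂ) • (x₀ - P.v)‖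
        ≤ G P.etheta * (‖x₀ - P.v‖ * ‖x₀ - P.v‖) := by
  refine ⟨?_, ?_⟩
  · intro h
    have h1 : P.v = x₀ := (sub_eq_zero.mp h).symm
    have h2 := P.norm_v hx₀
    rw [h1, hx₀] at h2
    linarith [P.hε.2]
  · rw [sub_self, norm_zero]
    exact mul_nonneg (hG0 _) (mul_nonneg (norm_nonneg _) (norm_nonneg _))

end MCStep

end Literature.Analysis.OperatorTheory.Enflo2023

end
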